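/-
Copyright (c) 2026 the pub-hodgecm-mathlib formalisation cell (harness21).  Prover seat hodgecm-mathlib-B-p04 (g35), heir of the EP pen of the (R2) Euler–Poincaré
road (LEAD F0P3a-plan (g10) WORDS T9-6 ∕ T9-8; F0P2-p02 (g9) 2026-09-01T09:19Z «(hI) … B-p04's»; dedup with A-p17 (g22) 09:37Z by head), 2026-09-01.
-/
import Literature.NumberTheory.Automorphic.HermitianLatticeTreeTransitive   -- ★ F0P2-p02 (g9): (hA), (hB) reshaped; `isUnimodular₂_iff_exists_mem_glInt`
import Literature.NumberTheory.Automorphic.HermitianLatticeTreeFrames       -- ★ A-p17 (g22) (T1-C): `exists_frame`, `isModularLattice_frame_iff`, `formCongr_mul`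
import HarnessLib

/-!
# `U(H)` is transitive on the EDGES of the lattice tree of a hermitian plane at an INERT place — the hypothesis (hI) of the elliptic Euler relation
# `#Fix(U⧸K) + #Fix(U⧸K′) = #Fix(U⧸(K ⊓ K′)) + 1` (Kottwitz 1988 §2; Serre, *Trees* II.1.1; Jacobowitz 1962 §8)

Topic `NumberTheory/Automorphic`; namespace `Literature.NumberTheory.Automorphic.HermitianLatticeTree`.  THEOREMS ONLY (no definition, no instance, no notation,
no named fact, no `sorry`); kernel lane.  Cell `pub/hodgecm-mathlib` (D-0151), crux H413 (`stmt-HodgeConjecture-24833`), line «N6nsGerm», the Euler–Poincaré road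
(R2) `stub_N6nsR2EP : RankOneEulerPoincareNonsplit`: the FLAG-TRANSITIVITY binder `hI` of ★ A-p17 (g22)
`HermitianLatticeTreeEulerRelation.natCard_fixedBy_add_eq_natCard_fixedBy_inf_add_one` (and of its hypothesis-form transport ★ `…EulerRelationCongr`),
discharged at an INERT place in the tokens of ★ `HermitianLatticeTreeDefs` ∕ ★ `HermitianLatticeTreeTransitive`.  HONEST LABEL: HC_CM is proved only modulo
the cell's remaining named inputs (hLiu418, h413) until rung 0 closes; nothing printed is asserted here — elementary lattice algebra over a valuation ring.

THE MATHEMATICS.  `𝒪 = 𝒪[E]` a DVR with uniformizer `ϖ`, `σ` valuation-preserving, `H` unimodular, `U = U(σ, H)`, `K = U ∩ GL₂(𝒪) = Stab(L₀)`, `L₀ = 𝒪² = latt 1`,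
`Λ₁ = latt g₁` a `ϖ`-modular neighbour of the root (`ϖL₀ ≤ Λ₁ ≤ L₀`).  (hI) = «`U` is transitive on the FLAGS `(L self-dual, Λ ϖ-modular, ϖL ≤ Λ ≤ L)`», the
edges of the tree.  Given (hA) (transitivity on self-dual lattices) it is equivalent to «**`K` is transitive on the star of the root**», the `ϖ`-modular `N` with
`ϖL₀ ≤ N ≤ L₀` (§1: move `L` to `L₀` by (hA), transport `Λ`, move it inside the star by `k ∈ K`, answer `u₀ k`).  In a Cartan frame (§2, any unimodular `H`,
★ `exists_frame` + ★ `isModularLattice_frame_iff`: exponents `(0,1)`, or `(1,0)` swapped by the column permutation `Φ₂`) such an `N` is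
`latt (P·diag(1, ϖ)) = 𝒪·Pe₀ + ϖL₀` with `P ∈ GL₂(𝒪)` and `h(Pe₀, Pe₀) = ((σP)ᵀ H P)₀₀ ∈ ϖ𝒪`: the star is the set of ISOTROPIC lines of the residual plane.
At an INERT place (`σ` an involution, `σa₀ − a₀` a UNIT for some integer `a₀`) and for `H = Φ₂ = antidiag(1,1)`, `K` moves `latt diag(1,ϖ)` to every such `N`
by an EXPLICIT integral unitary (§3): if `P₀₀` is a unit, `s := P₁₀∕P₀₀` has `σs + s ∈ ϖ𝒪` and `s′ := s − (σs + s)·σ(a₀)∕(σa₀ − a₀) ≡ s` is EXACTLY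
`σ`-antisymmetric, so the unitary unipotent `v(s′) = [[1,0],[s′,1]] ∈ K` has `(v(s′)⁻¹P)₁₀ = P₀₀(s − s′) ∈ ϖ𝒪`; if `P₀₀ ∈ ϖ𝒪`, `Φ₂ ∈ K` has `(Φ₂P)₁₀ = P₀₀`;
and `(k⁻¹P)₁₀ ∈ ϖ𝒪` gives `latt (k·d) = latt (P·d)` for `d = diag(1,ϖ)` (`d⁻¹(k⁻¹P)d ∈ GL₂(𝒪)`).  No residue field, no Hensel lift, no count (compare the
projective-line reading ★ `UnitaryTwoIwahoriStarFixedPoints.exists_glIntReduction_smul_eq_of_isotropic` of the same orbit statement).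

* §1 `forall_flag_exists_latt_eq_of_rootStar` — (hI) from (hA) + root-star transitivity `hK` (any `σ, ϖ, H, g₁`).
* §2 `exists_eq_latt_mul_diagonal_of_isModularLattice` — root-star normal form `N = latt (P·diag(ϖ⁰, ϖ¹))`, `P ∈ GL₂(𝒪)`, `|((σP)ᵀHP)₀₀| < 1` (any unimodular `H`, DVR).
* §3 `latt_mul_eq_latt_mul_of_valuation_lt_one`, `exists_mem_glInt_mover` — the explicit integral unitary at `H = antidiag(1,1)`, inert.
* §4 HEADS at `H = !![0,1;1,0]`, `↑g₁ = diagonal ![1, ϖ]`, inert: **`forall_isModularLattice_rootStar_exists_latt_mul_eq`** (`hK`),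
  **`forall_flag_exists_latt_eq_of_inert`** = the binder `hI` of ★ (T3)∕(T4) VERBATIM over (hA) as a hypothesis, and **`forall_flag_exists_latt_eq_of_isUnit_sub`** —
  (hA) discharged by ★ F0P2-p02 `forall_isSelfDualLattice_exists_latt_eq_of_isUnit_sub` (non-archimedean local field, `H ∈ GL₂(E)` with matrix `Φ₂`).

## References
* [Kottwitz1988] R. E. Kottwitz, *Tamagawa numbers*, Ann. of Math. 127 (1988), 629–646, §2 (facets of the building; the Euler–Poincaré function).
* [Serre1980Trees] J.-P. Serre, *Trees* (1980), Ch. II §1.1 (the tree of `SL₂` over a local field; the star of a vertex is `ℙ¹` of the residue field).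
* [Jacobowitz1962] R. Jacobowitz, *Hermitian forms over local fields*, Amer. J. Math. 84 (1962), §4, §7–§8 (unimodular and `𝔭`-modular lattices; hyperbolic planes).
* [BruhatTits1972] F. Bruhat, J. Tits, *Groupes réductifs sur un corps local I*, Publ. IHÉS 41 (1972), §10 (rank one: the building is a tree; stabilisers of facets).
-/

set_option autoImplicit false

noncomputable section

open scoped ValuativeRel Matrix MatrixGroups
open Matrix ValuativeRel

namespace Literature.NumberTheory.Automorphic.HermitianLatticeTree

open Literature.NumberTheory.Automorphic

variable {E : Type*} [Field E] [ValuativeRel E]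

/-! ## §1 (hI) from (hA) and the transitivity of `K` on the star of the root -/

section Generic

variable (σ : E →+* E) (ϖ : E) (H : Matrix (Fin 2) (Fin 2) E)

/-- **FLAG TRANSITIVITY FROM VERTEX TRANSITIVITY AND THE ROOT STAR.**  If `U(H)` is transitive on self-dual lattices (`hA`) and `K = U(H) ∩ GL₂(𝒪)` moves the
reference neighbour `latt g₁` of the root `L₀ = latt 1` to every `ϖ`-modular `N` with `ϖL₀ ≤ N ≤ L₀` (`hK`), then `U(H)` is transitive on the flags
`(M self-dual, N ϖ-modular, ϖM ≤ N ≤ M)`: the binder `hI` of ★ `natCard_fixedBy_add_eq_natCard_fixedBy_inf_add_one`.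
[cite: Kottwitz1988, §2] [cite: BruhatTits1972, §10] [cite: Serre1980Trees, II.1.1] -/
theorem forall_flag_exists_latt_eq_of_rootStar (g₁ : GL (Fin 2) E)
    (hA : ∀ M : Submodule 𝒪[E] (Fin 2 → E), IsSelfDualLattice σ H M →
      ∃ u : ↥(unitaryGroupOfForm σ H), latt (((u : GL (Fin 2) E)) : Matrix (Fin 2) (Fin 2) E) = M)
    (hK : ∀ N : Submodule 𝒪[E] (Fin 2 → E), IsModularLattice σ ϖ H N →
      scaleLattice ϖ (latt (1 : Matrix (Fin 2) (Fin 2) E)) ≤ N → N ≤ latt (1 : Matrix (Fin 2) (Fin 2) E) →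
      ∃ k : ↥(unitaryGroupOfForm σ H), (k : GL (Fin 2) E) ∈ glInt 2 E ∧
        latt (((k : GL (Fin 2) E) * g₁ : GL (Fin 2) E) : Matrix (Fin 2) (Fin 2) E) = N) :
    ∀ M N : Submodule 𝒪[E] (Fin 2 → E), IsSelfDualLattice σ H M → IsModularLattice σ ϖ H N → scaleLattice ϖ M ≤ N → N ≤ M →
      ∃ u : ↥(unitaryGroupOfForm σ H), latt (((u : GL (Fin 2) E)) : Matrix (Fin 2) (Fin 2) E) = M ∧
        latt (((u : GL (Fin 2) E) * g₁ : GL (Fin 2) E) : Matrix (Fin 2) (Fin 2) E) = N := by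
  intro M N hM hN h1 h2
  obtain ⟨u₀, hu₀⟩ := hA M hM
  -- transport the flag to the root by `u₀⁻¹`
  have hM' : mapGL ((u₀⁻¹ : ↥(unitaryGroupOfForm σ H)) : GL (Fin 2) E) M = latt (1 : Matrix (Fin 2) (Fin 2) E) := by
    rw [← hu₀, mapGL_latt, Subgroup.coe_inv, inv_mul_cancel, Units.val_one]
  have hN' : IsModularLattice σ ϖ H (mapGL ((u₀⁻¹ : ↥(unitaryGroupOfForm σ H)) : GL (Fin 2) E) N) :=
    isModularLattice_mapGL σ ϖ H _ (u₀⁻¹).2 hN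
  have h1' : scaleLattice ϖ (latt (1 : Matrix (Fin 2) (Fin 2) E)) ≤ mapGL ((u₀⁻¹ : ↥(unitaryGroupOfForm σ H)) : GL (Fin 2) E) N := by
    rw [← hM', ← mapGL_scaleLattice, mapGL_le_mapGL_iff]; exact h1
  have h2' : mapGL ((u₀⁻¹ : ↥(unitaryGroupOfForm σ H)) : GL (Fin 2) E) N ≤ latt (1 : Matrix (Fin 2) (Fin 2) E) := by
    rw [← hM', mapGL_le_mapGL_iff]; exact h2
  obtain ⟨k, hk, hkN⟩ := hK _ hN' h1' h2'
  refine ⟨u₀ * k, ?_, ?_⟩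
  · rw [Subgroup.coe_mul, latt_mul_of_mem_glInt _ _ hk, hu₀]
  · rw [Subgroup.coe_mul, mul_assoc, ← mapGL_latt, hkN, ← mapGL_mul, Subgroup.coe_inv, mul_inv_cancel, mapGL_one]

end Generic

/-! ## §2 The star of the root in a frame (any unimodular `H`, DVR) -/

section RootStar

variable (σ : E →+* E) (hσv : ∀ x : E, valuation E (σ x) = valuation E x) {ϖ : E} (hϖ : IsUniformizingElement ϖ)
  {H : Matrix (Fin 2) (Fin 2) E} (hH : IsUnimodular₂ H)

omit [ValuativeRel E] in
/-- `Φ₂ = antidiag(1,1)` is an involution. [cite: Serre1980Trees, II.1.1] -/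
private theorem antidiag_mul_antidiag : (!![(0 : E), 1; 1, 0] : Matrix (Fin 2) (Fin 2) E) * !![(0 : E), 1; 1, 0] = 1 := by
  rw [Matrix.mul_fin_two, Matrix.one_fin_two]; simp

omit [ValuativeRel E] in
/-- `Φ₂` is fixed by `Matrix.map` of a ring endomorphism. [cite: Serre1980Trees, II.1.1] -/
private theorem map_antidiag (f : E →+* E) : (!![(0 : E), 1; 1, 0] : Matrix (Fin 2) (Fin 2) E).map f = !![(0 : E), 1; 1, 0] := by
  ext i j; fin_cases i <;> fin_cases j <;> simp

omit [ValuativeRel E] in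
/-- `diag(a, b)` in the `!![·]` spelling. [cite: Serre1980Trees, II.1.1] -/
private theorem diagonal_vecTwo (a b : E) : Matrix.diagonal ![a, b] = !![a, 0; 0, b] := by
  ext i j; fin_cases i <;> fin_cases j <;> simp

omit [ValuativeRel E] in
/-- The column swap: `diag(a, b) = Φ₂ · diag(b, a) · Φ₂`. [cite: Serre1980Trees, II.1.1] -/
theorem diagonal_vecTwo_eq_antidiag_mul_diagonal_mul_antidiag (a b : E) :
    Matrix.diagonal ![a, b] = (!![(0 : E), 1; 1, 0] : Matrix (Fin 2) (Fin 2) E) * Matrix.diagonal ![b, a] * !![(0 : E), 1; 1, 0] := by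
  rw [diagonal_vecTwo, diagonal_vecTwo, Matrix.mul_fin_two, Matrix.mul_fin_two]; simp

/-- An element of `GL₂(E)` with matrix `Φ₂ = antidiag(1,1)` lies in `GL₂(𝒪)`. [cite: Serre1980Trees, II.1.1] -/
theorem mem_glInt_of_coe_eq_antidiag (w : GL (Fin 2) E) (hw : (w : Matrix (Fin 2) (Fin 2) E) = !![(0 : E), 1; 1, 0]) : w ∈ glInt 2 E := by
  refine mem_glInt_of_isIntegralMatrix (fun i j => ?_) ?_
  · rw [hw]; fin_cases i <;> fin_cases j <;> simp
  · rw [hw, Matrix.det_fin_two_of]; simp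

omit [ValuativeRel E] in
/-- The `(0,0)` Gram entry after the column swap is the old `(1,1)` entry: `((σ(PΦ₂))ᵀ H (PΦ₂))₀₀ = ((σP)ᵀ H P)₁₁`. [cite: Jacobowitz1962, §4] -/
theorem formCongr_mul_apply_zero_zero_of_coe_eq_antidiag (P w : GL (Fin 2) E) (hw : (w : Matrix (Fin 2) (Fin 2) E) = !![(0 : E), 1; 1, 0]) :
    formCongr σ (P * w) H 0 0 = formCongr σ P H 1 1 := by
  rw [formCongr_mul, hw, map_antidiag]
  simp [Matrix.mul_apply, Fin.sum_univ_two]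

include hσv hϖ hH in
/-- **THE STAR OF THE ROOT IN A FRAME.**  A `ϖ`-modular lattice `N` with `ϖL₀ ≤ N ≤ L₀` (`L₀ = latt 1`) is `latt (P·diag(ϖ⁰, ϖ¹)) = 𝒪·Pe₀ + ϖL₀` for some
`P ∈ GL₂(𝒪)` whose first column is residually ISOTROPIC: `|((σP)ᵀ H P)₀₀| < 1` (Cartan frame ★ `exists_frame`; the exponents are `(0,1)` or `(1,0)` by ★
`isModularLattice_frame_iff` and the two inclusions, and `(1,0)` is swapped to `(0,1)` by `Φ₂`). [cite: Serre1980Trees, II.1.1] [cite: Jacobowitz1962, §8] -/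
theorem exists_eq_latt_mul_diagonal_of_isModularLattice [IsDiscreteValuationRing 𝒪[E]] {N : Submodule 𝒪[E] (Fin 2 → E)}
    (hN : IsModularLattice σ ϖ H N) (h1 : scaleLattice ϖ (latt (1 : Matrix (Fin 2) (Fin 2) E)) ≤ N) (h2 : N ≤ latt (1 : Matrix (Fin 2) (Fin 2) E)) :
    ∃ P : GL (Fin 2) E, P ∈ glInt 2 E ∧ N = latt ((P : Matrix (Fin 2) (Fin 2) E) * Matrix.diagonal ![ϖ ^ (0 : ℤ), ϖ ^ (1 : ℤ)]) ∧
      valuation E (formCongr σ P H 0 0) < 1 := by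
  obtain ⟨g, rfl, -⟩ := id hN
  obtain ⟨P, hP, a, b, hfr⟩ := exists_frame hϖ g
  rw [hfr] at hN h1 h2 ⊢
  obtain ⟨hab, hent⟩ := (isModularLattice_frame_iff σ hσv hϖ hH P hP a b).1 hN
  have hle := (scaleLattice_zpow_latt_one_le_iff hϖ P hP a b 1).1 (by rwa [zpow_one])
  have hge := (latt_mul_diagonal_le_scaleLattice_zpow_latt_one_iff hϖ P hP a b 0).1 (by rwa [zpow_zero, scaleLattice_one])
  have hvϖ : valuation E ϖ ≠ 0 := (Valuation.ne_zero_iff _).2 hϖ.ne_zero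
  -- the entry bound `|ϖ|⁻¹ · |G i i| ≤ 1` gives `|G i i| ≤ |ϖ| < 1`
  have hentry : ∀ i : Fin 2, (![a, b] : Fin 2 → ℤ) i = 0 → valuation E (formCongr σ P H i i) < 1 := by
    intro i hi
    have h := hent i i
    rw [hi, show (0 : ℤ) + 0 - 1 = -1 by norm_num, _root_.zpow_neg, zpow_one] at h
    have h' : valuation E (formCongr σ P H i i) ≤ valuation E ϖ := by
      simpa only [← mul_assoc, mul_inv_cancel₀ hvϖ, one_mul, mul_one] using mul_le_mul_right h (valuation E ϖ)
    exact lt_of_le_of_lt h' hϖ.valuation_lt_one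
  rcases (show (a = 0 ∧ b = 1) ∨ (a = 1 ∧ b = 0) by omega) with ⟨rfl, rfl⟩ | ⟨rfl, rfl⟩
  · exact ⟨P, hP, rfl, hentry 0 rfl⟩
  · -- swap the columns by `Φ₂ ∈ GL₂(𝒪)`
    obtain ⟨w, hw⟩ : ∃ w : GL (Fin 2) E, (w : Matrix (Fin 2) (Fin 2) E) = !![(0 : E), 1; 1, 0] :=
      ⟨⟨!![(0 : E), 1; 1, 0], !![(0 : E), 1; 1, 0], antidiag_mul_antidiag, antidiag_mul_antidiag⟩, rfl⟩
    have hwK : w ∈ glInt 2 E := mem_glInt_of_coe_eq_antidiag w hw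
    refine ⟨P * w, Subgroup.mul_mem _ hP hwK, ?_, ?_⟩
    · -- `latt (P·diag(ϖ,1)) = latt ((P Φ₂)·diag(1,ϖ)·Φ₂) = latt ((P Φ₂)·diag(1,ϖ))`
      have hmat : ((P * w * zpowDiagGL (n := 2) hϖ.ne_zero ![0, 1] * w : GL (Fin 2) E) : Matrix (Fin 2) (Fin 2) E) =
          (P : Matrix (Fin 2) (Fin 2) E) * Matrix.diagonal ![ϖ ^ (1 : ℤ), ϖ ^ (0 : ℤ)] := by
        rw [Units.val_mul, Units.val_mul, Units.val_mul, coe_zpowDiagGL_two, hw,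
          diagonal_vecTwo_eq_antidiag_mul_diagonal_mul_antidiag (ϖ ^ (1 : ℤ)) (ϖ ^ (0 : ℤ))]
        simp only [Matrix.mul_assoc]
      rw [← hmat, latt_mul_of_mem_glInt _ _ hwK, Units.val_mul _ (zpowDiagGL (n := 2) hϖ.ne_zero ![0, 1]), coe_zpowDiagGL_two]
    · rw [formCongr_mul_apply_zero_zero_of_coe_eq_antidiag σ P w hw]
      exact hentry 1 rfl

end RootStar

/-! ## §3 The explicit integral unitary at `H = Φ₂ = antidiag(1,1)`, inert -/

section Mover

variable (σ : E →+* E) (hσv : ∀ x : E, valuation E (σ x) = valuation E x) {ϖ : E} (hϖ : IsUniformizingElement ϖ)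

omit [ValuativeRel E] in
/-- The unipotent `v(s) = [[1, 0], [s, 1]]` has inverse `v(−s)`. [cite: Serre1980Trees, II.1.1] -/
private theorem lowerUnipotent_mul_neg' (s : E) :
    (!![(1 : E), 0; s, 1] : Matrix (Fin 2) (Fin 2) E) * !![(1 : E), 0; -s, 1] = 1 ∧ (!![(1 : E), 0; -s, 1] : Matrix (Fin 2) (Fin 2) E) * !![(1 : E), 0; s, 1] = 1 := by
  rw [Matrix.mul_fin_two, Matrix.mul_fin_two, Matrix.one_fin_two]; constructor <;> simp

include hϖ in
/-- **`latt (k·d) = latt (P·d)` for `d = diag(1, ϖ)` as soon as `(k⁻¹P)₁₀ ∈ ϖ𝒪`** (`k, P ∈ GL₂(𝒪)`): then `d⁻¹ (k⁻¹ P) d` is integral with unit determinant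
(its off-diagonal entries are `ϖ·(k⁻¹P)₀₁` and `ϖ⁻¹·(k⁻¹P)₁₀`), ★ `span_range_transpose_eq_iff`. [cite: Serre1980Trees, II.1.1] -/
theorem latt_mul_eq_latt_mul_of_valuation_lt_one (k P : GL (Fin 2) E) (hk : k ∈ glInt 2 E) (hP : P ∈ glInt 2 E)
    (h10 : valuation E (((k⁻¹ * P : GL (Fin 2) E) : Matrix (Fin 2) (Fin 2) E) 1 0) < 1) :
    latt (((k * zpowDiagGL (n := 2) hϖ.ne_zero ![0, 1] : GL (Fin 2) E)) : Matrix (Fin 2) (Fin 2) E) =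
      latt (((P * zpowDiagGL (n := 2) hϖ.ne_zero ![0, 1] : GL (Fin 2) E)) : Matrix (Fin 2) (Fin 2) E) := by
  rw [latt, latt, span_range_transpose_eq_iff]
  have hQ : k⁻¹ * P ∈ glInt 2 E := Subgroup.mul_mem _ (Subgroup.inv_mem _ hk) hP
  have heq : (k * zpowDiagGL (n := 2) hϖ.ne_zero ![0, 1])⁻¹ * (P * zpowDiagGL (n := 2) hϖ.ne_zero ![0, 1]) =
      zpowDiagGL (n := 2) hϖ.ne_zero (-![0, 1]) * (k⁻¹ * P) * zpowDiagGL (n := 2) hϖ.ne_zero ![0, 1] := by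
    rw [_root_.mul_inv_rev, zpowDiagGL_neg]; group
  rw [heq]
  have hentry : ∀ i j : Fin 2, ((zpowDiagGL (n := 2) hϖ.ne_zero (-![0, 1]) * (k⁻¹ * P) * zpowDiagGL (n := 2) hϖ.ne_zero ![0, 1] : GL (Fin 2) E) :
      Matrix (Fin 2) (Fin 2) E) i j = ϖ ^ ((![0, 1] : Fin 2 → ℤ) j - (![0, 1] : Fin 2 → ℤ) i) * ((k⁻¹ * P : GL (Fin 2) E) : Matrix (Fin 2) (Fin 2) E) i j := by
    intro i j
    rw [Units.val_mul, Units.val_mul, coe_zpowDiagGL, coe_zpowDiagGL, Matrix.mul_diagonal, Matrix.diagonal_mul, Pi.neg_apply,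
      zpow_sub₀ hϖ.ne_zero, _root_.zpow_neg]
    ring
  refine mem_glInt_of_isIntegralMatrix (fun i j => ?_) ?_
  · rw [hentry]
    have hq : ((k⁻¹ * P : GL (Fin 2) E) : Matrix (Fin 2) (Fin 2) E) i j ∈ 𝒪[E] := apply_mem_integer_of_mem_glInt hQ i j
    fin_cases i <;> fin_cases j
    · simpa using hq
    · simpa using Subring.mul_mem _ hϖ.mem hq
    · simpa using hϖ.inv_mul_mem hq h10
    · simpa using hq
  · rw [Units.val_mul, Units.val_mul, Matrix.det_mul, Matrix.det_mul, map_mul, map_mul, valuation_det_eq_one_of_mem_glInt hQ, mul_one,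
      ← map_mul, mul_comm, ← Matrix.det_mul, ← Units.val_mul, ← zpowDiagGL_add, add_neg_cancel, zpowDiagGL_zero, Units.val_one, Matrix.det_one,
      map_one]

include hσv in
/-- **THE MOVER.**  `σ` an involution preserving the valuation, `a₀ ∈ 𝒪` with `σa₀ − a₀` a unit (INERT), `Φ₂ = antidiag(1,1)`: for every `P ∈ GL₂(𝒪)` whose
first column is residually isotropic (`|σ(P₀₀)P₁₀ + σ(P₁₀)P₀₀| < 1`) there is `k ∈ U(Φ₂) ∩ GL₂(𝒪)` with `|(k⁻¹P)₁₀| < 1` — the unitary unipotent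
`[[1,0],[s′,1]]`, `s′ = s − (σs + s)·σ(a₀)∕(σa₀ − a₀)`, `s = P₁₀∕P₀₀` if `P₀₀` is a unit, `Φ₂` otherwise. [cite: Serre1980Trees, II.1.1] [cite: Jacobowitz1962, §8] -/
theorem exists_mem_glInt_mover (hσσ : ∀ x, σ (σ x) = x) {a₀ : E} (ha₀ : a₀ ∈ 𝒪[E]) (ha₀u : valuation E (σ a₀ - a₀) = 1)
    (P : GL (Fin 2) E) (hP : P ∈ glInt 2 E)
    (h00 : valuation E (σ ((P : Matrix (Fin 2) (Fin 2) E) 0 0) * (P : Matrix (Fin 2) (Fin 2) E) 1 0 +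
      σ ((P : Matrix (Fin 2) (Fin 2) E) 1 0) * (P : Matrix (Fin 2) (Fin 2) E) 0 0) < 1) :
    ∃ k : ↥(unitaryGroupOfForm σ (!![(0 : E), 1; 1, 0] : Matrix (Fin 2) (Fin 2) E)), (k : GL (Fin 2) E) ∈ glInt 2 E ∧
      valuation E ((((k : GL (Fin 2) E)⁻¹ * P : GL (Fin 2) E) : Matrix (Fin 2) (Fin 2) E) 1 0) < 1 := by
  obtain ⟨p, hp⟩ : ∃ p : E, p = (P : Matrix (Fin 2) (Fin 2) E) 0 0 := ⟨_, rfl⟩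
  obtain ⟨r, hr⟩ : ∃ r : E, r = (P : Matrix (Fin 2) (Fin 2) E) 1 0 := ⟨_, rfl⟩
  rw [← hp, ← hr] at h00
  have hpO : p ∈ 𝒪[E] := hp ▸ apply_mem_integer_of_mem_glInt hP 0 0
  have hrO : r ∈ 𝒪[E] := hr ▸ apply_mem_integer_of_mem_glInt hP 1 0
  by_cases hpu : valuation E p = 1
  · -- `P₀₀` a unit: the unipotent `v(s′)`
    have hp0 : p ≠ 0 := fun h => by rw [h, map_zero] at hpu; exact zero_ne_one hpu
    have hd0 : σ a₀ - a₀ ≠ 0 := fun h => by rw [h, map_zero] at ha₀u; exact zero_ne_one ha₀u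
    have hσd : σ (σ a₀ - a₀) = -(σ a₀ - a₀) := by rw [map_sub, hσσ]; ring
    obtain ⟨c, hc⟩ : ∃ c : E, c = σ a₀ / (σ a₀ - a₀) := ⟨_, rfl⟩
    have hcO : c ∈ 𝒪[E] := by
      rw [Valuation.mem_integer_iff, hc, map_div₀, ha₀u, div_one, hσv]; exact (Valuation.mem_integer_iff _ _).1 ha₀
    have hσc : σ c + c = 1 := by
      rw [hc, map_div₀, hσσ, hσd]; field_simp; ring
    obtain ⟨s, hs⟩ : ∃ s : E, s = r / p := ⟨_, rfl⟩
    have hsO : s ∈ 𝒪[E] := by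
      rw [Valuation.mem_integer_iff, hs, map_div₀, hpu, div_one]; exact (Valuation.mem_integer_iff _ _).1 hrO
    obtain ⟨e, he⟩ : ∃ e : E, e = σ s + s := ⟨_, rfl⟩
    -- `e = (σ(p) r + σ(r) p) / (σ(p) p)` has valuation `< 1`
    have hσp0 : σ p ≠ 0 := fun h => hp0 (by simpa [hσσ] using congrArg σ h)
    have heq : e = (σ p * r + σ r * p) / (σ p * p) := by
      rw [he, hs, map_div₀]; field_simp; ring
    have hev : valuation E e < 1 := by
      rw [heq, map_div₀, map_mul, hσv, hpu, mul_one, div_one]; exact h00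
    have hσe : σ e = e := by rw [he, map_add, hσσ, add_comm]
    have heO : e ∈ 𝒪[E] := (Valuation.mem_integer_iff _ _).2 hev.le
    obtain ⟨s', hs'⟩ : ∃ s' : E, s' = s - e * c := ⟨_, rfl⟩
    have hs'O : s' ∈ 𝒪[E] := hs' ▸ Subring.sub_mem _ hsO (Subring.mul_mem _ heO hcO)
    have hσs' : σ s' = -s' := by
      have h2 : σ s = e - s := by rw [he]; ring
      have h3 : σ c = 1 - c := by rw [← hσc]; ring
      rw [hs', map_sub, map_mul, hσe, h2, h3]; ring
    obtain ⟨gv, hgv⟩ : ∃ gv : GL (Fin 2) E, (gv : Matrix (Fin 2) (Fin 2) E) = !![(1 : E), 0; s', 1] ∧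
        ((gv⁻¹ : GL (Fin 2) E) : Matrix (Fin 2) (Fin 2) E) = !![(1 : E), 0; -s', 1] :=
      ⟨⟨!![(1 : E), 0; s', 1], !![(1 : E), 0; -s', 1], (lowerUnipotent_mul_neg' s').1, (lowerUnipotent_mul_neg' s').2⟩, rfl, rfl⟩
    have hU : gv ∈ unitaryGroupOfForm σ (!![(0 : E), 1; 1, 0] : Matrix (Fin 2) (Fin 2) E) := by
      rw [mem_unitaryGroupOfForm_iff, hgv.1]
      ext i j; fin_cases i <;> fin_cases j <;> simp [Matrix.mul_apply, Fin.sum_univ_two, hσs']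
    have hK : gv ∈ glInt 2 E := by
      rw [mem_glInt_iff, hgv.1, hgv.2]
      constructor <;> intro i j <;> fin_cases i <;> fin_cases j <;> simp [hs'O]
    refine ⟨⟨gv, hU⟩, hK, ?_⟩
    -- `(v(s′)⁻¹ P)₁₀ = r − s′ p = p · e · c`
    have h10 : (((gv⁻¹ * P : GL (Fin 2) E)) : Matrix (Fin 2) (Fin 2) E) 1 0 = p * (e * c) := by
      rw [Units.val_mul, hgv.2, Matrix.mul_apply, Fin.sum_univ_two, ← hp, ← hr]
      have hr' : r = s * p := by rw [hs]; field_simp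
      simp [hr', hs']
      ring
    change valuation E ((((gv⁻¹ * P : GL (Fin 2) E)) : Matrix (Fin 2) (Fin 2) E) 1 0) < 1
    rw [h10, map_mul, hpu, one_mul, map_mul]
    calc valuation E e * valuation E c ≤ valuation E e * 1 := mul_le_mul_right ((Valuation.mem_integer_iff _ _).1 hcO) _
      _ < 1 := by rw [mul_one]; exact hev
  · -- `P₀₀ ∈ ϖ𝒪`: the swap `Φ₂`
    have hpv : valuation E p < 1 := lt_of_le_of_ne ((Valuation.mem_integer_iff _ _).1 hpO) hpu
    obtain ⟨gw, hgw⟩ : ∃ gw : GL (Fin 2) E, (gw : Matrix (Fin 2) (Fin 2) E) = !![(0 : E), 1; 1, 0] ∧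
        ((gw⁻¹ : GL (Fin 2) E) : Matrix (Fin 2) (Fin 2) E) = !![(0 : E), 1; 1, 0] :=
      ⟨⟨!![(0 : E), 1; 1, 0], !![(0 : E), 1; 1, 0], antidiag_mul_antidiag, antidiag_mul_antidiag⟩, rfl, rfl⟩
    have hU : gw ∈ unitaryGroupOfForm σ (!![(0 : E), 1; 1, 0] : Matrix (Fin 2) (Fin 2) E) := by
      rw [mem_unitaryGroupOfForm_iff, hgw.1, map_antidiag, Matrix.mul_assoc, antidiag_mul_antidiag, Matrix.mul_one]
      ext i j; fin_cases i <;> fin_cases j <;> rfl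
    refine ⟨⟨gw, hU⟩, mem_glInt_of_coe_eq_antidiag gw hgw.1, ?_⟩
    change valuation E ((((gw⁻¹ * P : GL (Fin 2) E)) : Matrix (Fin 2) (Fin 2) E) 1 0) < 1
    rw [Units.val_mul, hgw.2, Matrix.mul_apply, Fin.sum_univ_two, ← hp]
    simpa using hpv

end Mover

/-! ## §4 The heads: the root star and (hI) at `H = Φ₂`, inert -/

section Heads

variable (σ : E →+* E) (hσσ : ∀ x, σ (σ x) = x) (hσv : ∀ x : E, valuation E (σ x) = valuation E x) {ϖ : E} (hϖ : IsUniformizingElement ϖ)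

omit [ValuativeRel E] in
/-- The `(0,0)` Gram entry for `Φ₂`: `((σP)ᵀ Φ₂ P)₀₀ = σ(P₀₀) P₁₀ + σ(P₁₀) P₀₀ = h(Pe₀, Pe₀)`. [cite: Jacobowitz1962, §4] -/
theorem formCongr_antidiag_apply_zero_zero (P : GL (Fin 2) E) :
    formCongr σ P (!![(0 : E), 1; 1, 0] : Matrix (Fin 2) (Fin 2) E) 0 0 =
      σ ((P : Matrix (Fin 2) (Fin 2) E) 0 0) * (P : Matrix (Fin 2) (Fin 2) E) 1 0 + σ ((P : Matrix (Fin 2) (Fin 2) E) 1 0) * (P : Matrix (Fin 2) (Fin 2) E) 0 0 := by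
  simp [formCongr, Matrix.mul_apply, Fin.sum_univ_two]
  ring

/-- `Φ₂ = antidiag(1,1)` is unimodular. [cite: Jacobowitz1962, §7] -/
theorem isUnimodular₂_antidiag : IsUnimodular₂ (!![(0 : E), 1; 1, 0] : Matrix (Fin 2) (Fin 2) E) := by
  refine ⟨fun i j => ?_, ?_⟩
  · fin_cases i <;> fin_cases j <;> simp
  · rw [Matrix.det_fin_two_of]; simp

include hϖ in
/-- An element of `GL₂(E)` with matrix `diag(1, ϖ)` is the torus element `ϖ^{(0,1)}` of ★ `zpowDiagGL`. [cite: Serre1980Trees, II.1.1] -/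
theorem eq_zpowDiagGL_of_coe_eq_diagonal (g₁ : GL (Fin 2) E) (hg₁ : (g₁ : Matrix (Fin 2) (Fin 2) E) = Matrix.diagonal ![1, ϖ]) :
    g₁ = zpowDiagGL (n := 2) hϖ.ne_zero ![0, 1] :=
  Units.ext (by rw [hg₁, coe_zpowDiagGL_two, zpow_zero, zpow_one])

include hσσ hσv hϖ in
/-- **`K = U(Φ₂) ∩ GL₂(𝒪)` IS TRANSITIVE ON THE STAR OF THE ROOT** at an INERT place (`σ` a valuation-preserving involution, `σa₀ − a₀` a unit for some
`a₀ ∈ 𝒪`; `𝒪` a DVR with uniformizer `ϖ`; `↑g₁ = diag(1, ϖ)`): every `ϖ`-modular `N` with `ϖL₀ ≤ N ≤ L₀` is `latt (k g₁) = k · (𝒪e₀ ⊕ ϖ𝒪e₁)` for some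
`k ∈ U(Φ₂)` with `k ∈ GL₂(𝒪)` — the `q + 1` isotropic lines of the residual hermitian plane form ONE `K`-orbit.
[cite: Serre1980Trees, II.1.1] [cite: BruhatTits1972, §10] [cite: Jacobowitz1962, §8] -/
theorem forall_isModularLattice_rootStar_exists_latt_mul_eq [IsDiscreteValuationRing 𝒪[E]]
    {a₀ : E} (ha₀ : a₀ ∈ 𝒪[E]) (ha₀u : valuation E (σ a₀ - a₀) = 1)
    {J : Matrix (Fin 2) (Fin 2) E} (hJ : J = !![0, 1; 1, 0]) (g₁ : GL (Fin 2) E) (hg₁ : (g₁ : Matrix (Fin 2) (Fin 2) E) = Matrix.diagonal ![1, ϖ]) :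
    ∀ N : Submodule 𝒪[E] (Fin 2 → E), IsModularLattice σ ϖ J N →
      scaleLattice ϖ (latt (1 : Matrix (Fin 2) (Fin 2) E)) ≤ N → N ≤ latt (1 : Matrix (Fin 2) (Fin 2) E) →
      ∃ k : ↥(unitaryGroupOfForm σ J), (k : GL (Fin 2) E) ∈ glInt 2 E ∧
        latt (((k : GL (Fin 2) E) * g₁ : GL (Fin 2) E) : Matrix (Fin 2) (Fin 2) E) = N := by
  subst hJ
  intro N hN h1 h2
  obtain ⟨P, hP, hNP, h00⟩ := exists_eq_latt_mul_diagonal_of_isModularLattice σ hσv hϖ isUnimodular₂_antidiag hN h1 h2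
  rw [formCongr_antidiag_apply_zero_zero] at h00
  obtain ⟨k, hk, h10⟩ := exists_mem_glInt_mover σ hσv hσσ ha₀ ha₀u P hP h00
  refine ⟨k, hk, ?_⟩
  rw [hNP, eq_zpowDiagGL_of_coe_eq_diagonal hϖ g₁ hg₁, latt_mul_eq_latt_mul_of_valuation_lt_one hϖ _ P hk hP h10, Units.val_mul,
    coe_zpowDiagGL_two]

include hσσ hσv hϖ in
/-- **(hI) AT AN INERT PLACE: `U(Φ₂)` IS TRANSITIVE ON THE EDGES OF ITS TREE** — the binder `hI` of ★
`HermitianLatticeTreeEulerRelation.natCard_fixedBy_add_eq_natCard_fixedBy_inf_add_one` ∕ ★ `…EulerRelationCongr` VERBATIM at `H = Φ₂`, `↑g₁ = diag(1, ϖ)`,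
granted transitivity on self-dual lattices `hA` (★ `HermitianLatticeTreeTransitive.forall_isSelfDualLattice_exists_latt_eq_of_selfDualLocus` and its
dischargings): for `M` self-dual, `N` `ϖ`-modular with `ϖM ≤ N ≤ M` there is `u ∈ U(Φ₂)` with `latt u = M` and `latt (u g₁) = N`.
[cite: Kottwitz1988, §2] [cite: BruhatTits1972, §10] [cite: Serre1980Trees, II.1.1] -/
theorem forall_flag_exists_latt_eq_of_inert [IsDiscreteValuationRing 𝒪[E]]
    {a₀ : E} (ha₀ : a₀ ∈ 𝒪[E]) (ha₀u : valuation E (σ a₀ - a₀) = 1)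
    {J : Matrix (Fin 2) (Fin 2) E} (hJ : J = !![0, 1; 1, 0]) (g₁ : GL (Fin 2) E) (hg₁ : (g₁ : Matrix (Fin 2) (Fin 2) E) = Matrix.diagonal ![1, ϖ])
    (hA : ∀ M : Submodule 𝒪[E] (Fin 2 → E), IsSelfDualLattice σ J M →
      ∃ u : ↥(unitaryGroupOfForm σ J), latt (((u : GL (Fin 2) E)) : Matrix (Fin 2) (Fin 2) E) = M) :
    ∀ M N : Submodule 𝒪[E] (Fin 2 → E), IsSelfDualLattice σ J M → IsModularLattice σ ϖ J N → scaleLattice ϖ M ≤ N → N ≤ M →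
      ∃ u : ↥(unitaryGroupOfForm σ J), latt (((u : GL (Fin 2) E)) : Matrix (Fin 2) (Fin 2) E) = M ∧
        latt (((u : GL (Fin 2) E) * g₁ : GL (Fin 2) E) : Matrix (Fin 2) (Fin 2) E) = N :=
  forall_flag_exists_latt_eq_of_rootStar σ ϖ J g₁ hA (forall_isModularLattice_rootStar_exists_latt_mul_eq σ hσσ hσv hϖ ha₀ ha₀u hJ g₁ hg₁)

end Heads

/-! ## §4b (hI) discharged over a non-archimedean local field (the shape of ★ `HermitianLatticeTreeTransitive` §3) -/

section LocalField

variable {F : Type*} [Field F] [ValuativeRel F] [UniformSpace F] [IsUniformAddGroup F] [IsNonarchimedeanLocalField F] (τ : F →+* F)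

/-- **(hI) DISCHARGED** at an inert place, in the binder shapes of ★ `forall_isSelfDualLattice_exists_latt_eq_of_isUnit_sub` (F0P2-p02 (g9)): `F` a
non-archimedean local field with `𝒪` a DVR and uniformizer `ϖ`, `τ` a valuation-preserving involution of `F` preserving `𝒪` with `τ a − a` a unit for some
`a ∈ 𝒪`, the form `H ∈ GL₂(𝒪)` with matrix `Φ₂ = antidiag(1,1)`, `↑g₁ = diag(1, ϖ)`: `U(H)` is transitive on the flags `(M self-dual, N ϖ-modular, ϖM ≤ N ≤ M)`
— the binder `hI` of ★ `natCard_fixedBy_add_eq_natCard_fixedBy_inf_add_one` with nothing left to supply.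
[cite: Kottwitz1988, §2] [cite: Jacobowitz1962, §7 Thm. 7.1, §8] [cite: Serre1980Trees, II.1.1] -/
theorem forall_flag_exists_latt_eq_of_isUnit_sub [IsDiscreteValuationRing 𝒪[F]] (hττ : ∀ x, τ (τ x) = x)
    (hτv : ∀ x : F, valuation F (τ x) = valuation F x) (hτO : ∀ x : 𝒪[F], τ x ∈ 𝒪[F])
    (a : 𝒪[F]) (ha : IsUnit ((⟨τ a, hτO a⟩ : 𝒪[F]) - a)) {ϖ : F} (hϖ : IsUniformizingElement ϖ)
    (H : GL (Fin 2) F) (hH : (H : Matrix (Fin 2) (Fin 2) F) = !![0, 1; 1, 0])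
    (g₁ : GL (Fin 2) F) (hg₁ : (g₁ : Matrix (Fin 2) (Fin 2) F) = Matrix.diagonal ![1, ϖ]) :
    ∀ M N : Submodule 𝒪[F] (Fin 2 → F), IsSelfDualLattice τ (H : Matrix (Fin 2) (Fin 2) F) M → IsModularLattice τ ϖ (H : Matrix (Fin 2) (Fin 2) F) N →
      scaleLattice ϖ M ≤ N → N ≤ M →
      ∃ u : ↥(unitaryGroupOfForm τ (H : Matrix (Fin 2) (Fin 2) F)), latt (((u : GL (Fin 2) F)) : Matrix (Fin 2) (Fin 2) F) = M ∧
        latt (((u : GL (Fin 2) F) * g₁ : GL (Fin 2) F) : Matrix (Fin 2) (Fin 2) F) = N := by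
  have hHK : H ∈ glInt 2 F := mem_glInt_of_coe_eq_antidiag H hH
  have hHh : ((H : Matrix (Fin 2) (Fin 2) F).map τ)ᵀ = H := by
    rw [hH]; ext i j; fin_cases i <;> fin_cases j <;> simp
  have hau : valuation F (τ (a : F) - a) = 1 := by
    have h := ((Valuation.integer.integers (valuation F)).isUnit_iff_valuation_eq_one).1 ha
    exact h
  exact forall_flag_exists_latt_eq_of_inert τ hττ hτv hϖ a.2 hau hH g₁ hg₁
    (forall_isSelfDualLattice_exists_latt_eq_of_isUnit_sub τ hττ hτO a ha H hHK hHh)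

end LocalField

end Literature.NumberTheory.Automorphic.HermitianLatticeTree

end
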